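import Literature.MathematicalPhysics.QuantumFieldTheory.Balaban1983to89.Node00.CarriersB13
import Literature.MathematicalPhysics.QuantumFieldTheory.Balaban1983to89.Beta.RemainderStepAdapterHolo

/-!
# `Beta.RemainderWOfRecordB13` — the (D4) wall's `W` field AT NODE 00's [B13] objects of record: the `W`-adapter
# `W m := (WtOfRecord θ (lam m)).toTorusStep` along a (1.21) sequence of residual layers, the three one-step laws in
# the record's words (p. 15 restriction, (2.13), Lemma 3 (2.38) = N10's [B13] leaf), and the wall
# `RemainderLocalityHolo.PolLeavesTFac190H` INHABITED MODULO exactly the remaining leaves stated ON THOSE OBJECTS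

Cell pub-balaban, β-function sub-cell, BINDER row (D4) OWNER lineage `b2b-balaban-beta-an4` (gen 122; memo
`HOME/b2b-balaban-beta-an4/FLAT-LETTERS-LOCATED.md` §27 (iv) «the natural trigger of this lineage's next build (the
`W`-adapter)» and §32; pub-ymgap bus l.12213 [AN4-G121-B13-PIN-READ] ∕ node00-def-B13's INTENT l.12447 (W) and
`Node00/CarriersB13.lean` (p457685) ll. 61–64 «FAMILY FORM (pub-balaban an4's (D4) wall, [I] (1.21)): … a (1.21) sequence
T ↗ ℤ⁴ is a sequence of layers `lamSeq : ℕ → ResidB13 θ` with `(lamSeq m).n ↗` and `W m := (WtOfRecord θ (lamSeq m)).toTorusStep`»;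
dag-ref-D g20's WATCH-D4-TORUS-SEQUENCE l.12355: «locate the witness's `N`∕`hNlim`∕`W` and check `W n` varies along a
torus sequence of record»).
[Balaban1987RG1] = T. Bałaban, *Renormalization group approach to lattice gauge field theories. I*, Commun. Math. Phys.
**109** (1987) 249–301; [Balaban1988RG2Cluster] = part II, Commun. Math. Phys. **116** (1988) 1–22;
[Balaban1985Variational] = T. Bałaban, *Propagators for lattice gauge theories in a background field*, Commun. Math. Phys.
**99** (1985) 389–434 ∕ the variational problem, (190) p. 308.

WHY.  The (D4) wall `PolLeavesTFac190H d M a c ℓ α₂ q` (`Beta/RemainderLocalityHolo` :201) — consumed at NODE 00's β of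
record as the hypothesis `hleaves` ∕ `L` of `Summits/…/BalabanUVNodesN26BetaContMerged` and
`…N26AtBetaOfRecord11StepObjects.exists_chainTFac190H_oneLoopSplitOfRecord₁₁_of_leafLists` — takes per (scale, history)
an exhausting torus sequence `N ∕ hNlim` and ONE-STEP DATA `W : (n : ℕ) → TorusStep d (N n)` ([I] (1.21) p. 264
*"T^{(j+1)} ↗ ℤ^d"*), then the laws `hsp ∕ hrep ∕ h238` and the (4.4) ∕ (190) ∕ (1.7) leaves ON THAT OBJECT.  Since
2026-08-19 the `W` field was «THE INSTANCE, ownerless» (`HOME/b2b-balaban-beta-an4/D4-INSTANCE-LINKS.md` §2).  NODE 00's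
[B13] carrier pin now DEFINES the two-scale torus step of record `Node00.WtOfRecord θ lam : TwoTorusStep 4 (θ.ℓ₆+1) (lam.n+1)`
for EVERY residual term layer `lam : Node00.ResidB13 θ` (its `Vp ∕ Vpp ∕ V ∕ Q ∕ H` the displayed sums of the layer's terms,
(1.33) ∕ (1.41)–(1.42) ∕ (2.9)–(2.14)), parametric in the coarse torus size `lam.n + 1`.  This module is the ONE-LINE
adapter promised in memo §27 (iv) and its bookkeeping consequences, so that the N26 consumers and the referee's read rule
have the (D4) wall's `W` AT THE RECORD's OBJECTS by name.

WHAT IS PROVED (0 sorry; [folklore] bookkeeping over existing carriers + the printed shapes):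
* §1 `wallW lam := (WtOfRecord θ lam).toTorusStep : TorusStep 4 (lam.n + 1)` and its four faces read by the wall
  (`Φ, sp2, H, Ek1` are THE LAYER's — `rfl`); the torus sequence `NOfLayers lam m := (lam m).n + 1` of a layer sequence
  and `tendsto_NOfLayers` ((1.21): `(lam m).n ↗ ⟹ N ↗`).
* §2 the three one-step laws IN THE LAYER's WORDS and their wall forms: `SpLaw` (p. 15 restriction of the spaces
  `lam.sp2`) ⟹ `hsp` (`spRestr_of_spLaw`); `Law213` ((2.13): the layer's `Ek1` IS the X-localized log of the polymer gas
  with the layer's activities `H`) ⟹ `hrep` (`repr213_of_law213`); and **N10's [B13] leaf at the layer**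
  (`Node00.B13LeafOfRecord θ lam`, third conjunct = Lemma 3 AS PRINTED) + the layer's restriction sentence `lam.Restr` ⟹
  the wall's `h238` at the constants of record and the printed transfer factor ℓ = L∕2
  (`bound238With_of_b13LeafOfRecord`, `…_L`; sequence form `h238_of_b13Leaves` at common constants).
* §3 the bridge to the crew's thin step-object currency (`RemainderStepAdapterHolo.StepObjectD4`, consumed at the record by
  `…N26AtBetaOfRecord11StepObjects.exists_chainTFac190H_oneLoopSplitOfRecord₁₁_of_stepObjects`): `stepObject lam hsp`
  (`Φ, sp2, H` := the layer's), `lemma3OnH_stepObject_iff` (`Iff.rfl` with the wall's `h238` on `WtOfRecord`),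
  `stepObject_E_eq` (under `Law213` its (2.13)-DEFINED `E` agrees with the layer's `Ek1` on `sp2 X`).
* §4 **the adapter** `polLeavesTFac190H_ofLayers`: a layer sequence with `(lam m).n ↗`, the laws `SpLaw ∕ Law213` and
  (2.38)_ℓ on every layer, and EXACTLY the remaining leaves stated on the layers' own `Φ ∕ sp2 ∕ Ek1` — the (4.4) seam
  (`Wn, emb, hemb, hdiff`), the (190)-side data `Data190 4 M (NOfLayers lam) Wn q`, the (1.7)-factorization ∕
  test-vector-limit data with the read-out `a` — GIVE `PolLeavesTFac190H 4 M a c ℓ α₂ q` whose `W` IS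
  `fun m => (WtOfRecord θ (lam m)).toTorusStep` and whose `N` IS `fun m => (lam m).n + 1` (`…_W`, `…_N`: `rfl` — the
  referee's WATCH-D4-TORUS-SEQUENCE handles); §4′ `polLeavesTFac190H_ofLayersOfActivities`: the same with the E-layer
  leaf `hdiff` DERIVED from holomorphy of the layers' ACTIVITIES along the seam ([II] p. 15) by road P3's
  `RemainderSeamHolo.hdiff_of_activities` (price `CondsL 4 c ℓ`, `0 ≤ C₃ε₁`); §4″ `polLeavesTFac190H_ofRecordB13`: the
  same with `h238` supplied by N10's [B13] leaves at common constants of record (ℓ = L∕2).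
HONEST FRAMING.  Interface bookkeeping between two typed sockets (NODE 00's X.B13 pin, the (D4) wall); every law and
leaf is a displayed HYPOTHESIS on the record's residual objects; nothing of Bałaban's is asserted or constructed; no
estimate is proved; row (D4) NOT discharged (instance 0∕1; critical-path width 0 = NODE O; D4 DISCHARGE NO DATE); NOT
NODE O, NOT N10, NOT B12 Thm 2, NOT BetaPertH, NOT continuum, NOT Clay.  HONEST DEPENDENCY: continuum YM on T⁴ ⇐
BetaPertH ∧ nine spine estimates (0∕9 proved); BetaPertH ⇐ (D1) ∧ (D4) ∧ CAP+tail.  No `sorry`, no `axiom`, no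
`instance` declaration, no `notation`.
-/

noncomputable section

open Metric Filter Topology Set

namespace Literature.MathematicalPhysics.QuantumFieldTheory.Balaban1983to89.Beta.RemainderWOfRecordB13

open Literature.MathematicalPhysics.QuantumFieldTheory.Balaban1983to89
open Literature.MathematicalPhysics.QuantumFieldTheory.Balaban1983to89.Node00
  (Stage3Params ResidB13 WtOfRecord c13OfRecord c13OfRecord_L c13OfRecord_L_eq_L B13LeafOfRecord)
open Literature.MathematicalPhysics.QuantumFieldTheory.Balaban1983to89.B13Resummation (SpRestr Repr213 locE)
open Literature.MathematicalPhysics.QuantumFieldTheory.Balaban1983to89.TreeLengthTorus (TPt TDom proj tsys)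
open Literature.MathematicalPhysics.QuantumFieldTheory.Balaban1983to89.TreeLengthTorusGeometry (TorusStep TTouch)
open Literature.MathematicalPhysics.QuantumFieldTheory.Balaban1983to89.B13Lemma3Torus (TwoTorusStep)
open Literature.MathematicalPhysics.QuantumFieldTheory.Balaban1983to89.B13ScaleTransfer (Pt)
open Literature.MathematicalPhysics.QuantumFieldTheory.Balaban1983to89.B12Decay510 (mixedDeriv)
open Literature.MathematicalPhysics.QuantumFieldTheory.Balaban1983to89.Beta.RemainderLimitTorus
open Literature.MathematicalPhysics.QuantumFieldTheory.Balaban1983to89.Beta.RemainderLocality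
open Literature.MathematicalPhysics.QuantumFieldTheory.Balaban1983to89.Beta.RemainderDecay190 (Consts190 Data190)
open Literature.MathematicalPhysics.QuantumFieldTheory.Balaban1983to89.Beta.RemainderLocalityHolo
open Literature.MathematicalPhysics.QuantumFieldTheory.Balaban1983to89.Beta.RemainderChainLattice (CondsL)
open Literature.MathematicalPhysics.QuantumFieldTheory.Balaban1983to89.Beta.RemainderSeamHolo (hdiff_of_activities)
open Literature.MathematicalPhysics.QuantumFieldTheory.Balaban1983to89.Beta.RemainderStepAdapterHolo (StepObjectD4)

variable {θ : Stage3Params}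

/-! ## §1 The wall's `W` at one residual layer, and the torus sequence of a layer sequence -/

/-- **THE `W`-ADAPTER AT ONE LAYER**: the two-scale torus step of record `WtOfRecord θ lam` read as the (one-)torus
step data the (D4) wall's field `W n : TorusStep d (N n)` wants, with N := the COARSE torus size `lam.n + 1`
(`B13Lemma3Torus.TwoTorusStep.toTorusStep`: 𝐃_k := `tsys 4 ((θ.ℓ₆+1)·(lam.n+1))`, every other field the step's).
[cite: Balaban1987RG1, (1.21) p.264; Balaban1988RG2Cluster, (1.1)–(2.13) pp.3–14 (carrier)] -/
abbrev wallW (lam : ResidB13 θ) : TorusStep 4 (lam.n + 1) := (WtOfRecord θ lam).toTorusStep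

/-- The adapter's configurations ARE the layer's (𝐔, 𝐉, B). [cite: Balaban1988RG2Cluster, (1.1)–(2.13) pp.3–14 (carrier)] -/
theorem wallW_Φ (lam : ResidB13 θ) : (wallW lam).Φ = lam.Φ := rfl

/-- The adapter's analyticity domains ARE the layer's spaces Uᶜ_{k+1}(·, α₀, α₁) of p. 15. [cite: Balaban1988RG2Cluster, p.15] -/
theorem wallW_sp2 (lam : ResidB13 θ) : (wallW lam).sp2 = lam.sp2 := rfl

/-- The adapter's activities ARE the layer's H(Z) = Σ_{(𝐃,P)} T_{(𝐃,P)}(Z) ((2.9)–(2.14): the displayed sum of the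
layer's terms, `Node00.WtOfRecord_H`). [cite: Balaban1988RG2Cluster, (2.9) p.14 and (2.14) p.15] -/
theorem wallW_H (lam : ResidB13 θ) : (wallW lam).H = lam.H := rfl

/-- The adapter's E^{(k+1)} IS the layer's (p. 21). [cite: Balaban1988RG2Cluster, (2.13) p.14 and p.21] -/
theorem wallW_Ek1 (lam : ResidB13 θ) : (wallW lam).Ek1 = lam.Ek1 := rfl

/-- The adapter's 𝐃_{k+1} is the COARSE torus system `tsys 4 (lam.n + 1)`, definitionally.
[cite: Balaban1988RG2Cluster, p.13 («cubes of the size LM»)] -/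
theorem wallW_Dk1 (lam : ResidB13 θ) : (wallW lam).toStepData.Dk1 = tsys 4 (lam.n + 1) := rfl

/-- **THE EXHAUSTING TORI OF A LAYER SEQUENCE** ([I] (1.21) *"T^{(j+1)} ↗ ℤ^d"*): `N m := (lam m).n + 1`, the coarse
torus size of the m-th layer. [cite: Balaban1987RG1, (1.21) p.264] -/
abbrev NOfLayers (lam : ℕ → ResidB13 θ) (m : ℕ) : ℕ := (lam m).n + 1

/-- `N m = (lam m).n + 1` (`rfl`). [cite: Balaban1987RG1, (1.21) p.264 (bookkeeping)] -/
theorem NOfLayers_apply (lam : ℕ → ResidB13 θ) (m : ℕ) : NOfLayers lam m = (lam m).n + 1 := rfl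

/-- (1.21): if the layers' torus indices grow without bound, so do the tori `N m = (lam m).n + 1` — the wall's field
`hNlim`. [cite: Balaban1987RG1, (1.21) p.264] -/
theorem tendsto_NOfLayers {lam : ℕ → ResidB13 θ} (hn : Tendsto (fun m => (lam m).n) atTop atTop) :
    Tendsto (NOfLayers lam) atTop atTop :=
  (tendsto_add_atTop_nat 1).comp hn

/-! ## §2 The three one-step laws in the layer's words, and their wall forms -/

/-- **The p. 15 restriction law of the layer's spaces**: a configuration in Uᶜ_{k+1}(X, α₀, α₁) lies in
Uᶜ_{k+1}(Z, α₀, α₁) for every domain Z ⊆ X (*"we can restrict them, as analytic functions, to the above subspace"*).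
A hypothesis shape on the residual field `lam.sp2`. [cite: Balaban1988RG2Cluster, p.15] -/
def SpLaw (lam : ResidB13 θ) : Prop :=
  ∀ X Z : TDom 4 (lam.n + 1), ∀ φ, Z.1 ⊆ X.1 → φ ∈ lam.sp2 X → φ ∈ lam.sp2 Z

/-- The restriction law gives the wall's field `hsp` at the layer (`TorusStep.spRestr`). [cite: Balaban1988RG2Cluster, p.15] -/
theorem spRestr_of_spLaw {lam : ResidB13 θ} (h : SpLaw lam) :
    SpRestr (WtOfRecord θ lam).toStepData (wallW lam).geom :=
  TorusStep.spRestr _ h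

open Classical in
/-- **The representation (2.13) as a LAW on the layer**: on Uᶜ_{k+1}(X, α₀, α₁) the layer's E^{(k+1)}(X, φ) IS the
X-localized part of log Ξ of the polymer gas on the coarse torus with the incompatibility (2.11) and activities
Z ↦ H(Z, φ) (*"E^{(k+1)}(X) = Σ_{n} (1/n!) Σ_{(Z₁,…,Z_n): ∪Z_i = X} ρ^T(Z₁,…,Z_n)H(Z₁)⋯H(Z_n)"*).  A hypothesis shape
relating the residual fields `lam.Ek1` and `lam.H`. [cite: Balaban1988RG2Cluster, (2.13) p.14] -/
def Law213 (lam : ResidB13 θ) : Prop :=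
  ∀ X : TDom 4 (lam.n + 1), ∀ φ, φ ∈ lam.sp2 X →
    lam.Ek1 X φ = locE (TTouch (d := 4) (N := lam.n + 1)) (fun Z : (tsys 4 (lam.n + 1)).Dom => Z.1)
      (fun Z => lam.H Z φ) X.1

open Classical in
/-- The (2.13) law gives the wall's field `hrep` at the layer (`TorusStep.repr213`). [cite: Balaban1988RG2Cluster, (2.13) p.14] -/
theorem repr213_of_law213 {lam : ResidB13 θ} (h : Law213 lam) :
    Repr213 (WtOfRecord θ lam).toStepData (wallW lam).geom :=
  TorusStep.repr213 _ h

/-- **N10's [B13] LEAF AT THE LAYER GIVES THE WALL's `h238`**: the third conjunct of `Node00.B13LeafOfRecord θ lam` is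
Lemma 3 AS PRINTED (`B13.Lemma3Printed` := restrictions → (2.38)) for the step and the constants of record; with the
layer's restriction sentence it IS `B13.Bound238With … (c13OfRecord θ lam) (L/2)` (`B13.bound238With_half`), the wall's
Lemma-3 leaf at the printed transfer factor ℓ = ½L. [cite: Balaban1988RG2Cluster, Lemma 3 (2.38) p.20] -/
theorem bound238With_of_b13LeafOfRecord {lam : ResidB13 θ} (hleaf : B13LeafOfRecord θ lam) (hR : lam.Restr) :
    B13.Bound238With (WtOfRecord θ lam).toStepData (c13OfRecord θ lam) (((c13OfRecord θ lam).L : ℝ) / 2) :=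
  (B13.bound238With_half _ _).2 (hleaf.2.2 hR)

/-- The same with the transfer factor displayed as ½·(the run's block size) `θ.L` (`Node00.c13OfRecord_L_eq_L`).
[cite: Balaban1988RG2Cluster, Lemma 3 (2.38) p.20] -/
theorem bound238With_of_b13LeafOfRecord_L {lam : ResidB13 θ} (hleaf : B13LeafOfRecord θ lam) (hR : lam.Restr) :
    B13.Bound238With (WtOfRecord θ lam).toStepData (c13OfRecord θ lam) ((θ.L : ℝ) / 2) := by
  rw [← c13OfRecord_L_eq_L θ lam]
  exact bound238With_of_b13LeafOfRecord hleaf hR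

/-- **Sequence form**: along a layer sequence with COMMON constants of record `c` (the wall's constants are torus-free
BY TYPE — Lemma 3's constants do not depend on the torus), N10's [B13] leaves and the restriction sentences give the
wall's field `h238` at ℓ = ½L. [cite: Balaban1988RG2Cluster, Lemma 3 (2.38) p.20] -/
theorem h238_of_b13Leaves {lam : ℕ → ResidB13 θ} {c : B13.Consts} (hc : ∀ m, c13OfRecord θ (lam m) = c)
    (hleaf : ∀ m, B13LeafOfRecord θ (lam m)) (hR : ∀ m, (lam m).Restr) (m : ℕ) :
    B13.Bound238With (WtOfRecord θ (lam m)).toStepData c ((c.L : ℝ) / 2) := by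
  rw [← hc m]
  exact bound238With_of_b13LeafOfRecord (hleaf m) (hR m)

/-! ## §3 The bridge to the thin step-object currency `StepObjectD4` -/

/-- **The crew's thin step object READ OFF THE LAYER**: configurations, spaces and activities := the layer's, the
restriction property := the layer's p. 15 law.  (Its `toTorusStep` fills the Lemma 1–2 fields with inert values and
DEFINES E^{(k+1)} by (2.13) — `StepObjectD4.E`; the faithful road of §4 reads the layer's own `Ek1` instead.)
[cite: Balaban1988RG2Cluster, (2.9) p.14 and p.15] -/
def stepObject (lam : ResidB13 θ) (hsp : SpLaw lam) : StepObjectD4 4 (lam.n + 1) where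
  Φ := lam.Φ
  sp2 := lam.sp2
  H := lam.H
  hsp := hsp

/-- Lemma 3 (2.38)_ℓ displayed on the thin object's activities IS the wall's `h238` on the step of record (same `H`,
same spaces, same coarse-torus tree length). [cite: Balaban1988RG2Cluster, (2.38) p.20] -/
theorem lemma3OnH_stepObject_iff (lam : ResidB13 θ) (hsp : SpLaw lam) {c : B13.Consts} {ℓ : ℝ} :
    (stepObject lam hsp).Lemma3OnH c ℓ ↔ B13.Bound238With (WtOfRecord θ lam).toStepData c ℓ :=
  Iff.rfl

open Classical in
/-- Under the (2.13) law the thin object's (2.13)-DEFINED E^{(k+1)} agrees with the layer's on Uᶜ_{k+1}(X, α₀, α₁).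
[cite: Balaban1988RG2Cluster, (2.13) p.14] -/
theorem stepObject_E_eq {lam : ResidB13 θ} (hsp : SpLaw lam) (h213 : Law213 lam) {X : TDom 4 (lam.n + 1)}
    {φ : lam.Φ} (hφ : φ ∈ lam.sp2 X) : (stepObject lam hsp).E X φ = lam.Ek1 X φ :=
  (h213 X φ hφ).symm

/-! ## §4 The adapter: the wall from a layer sequence + the laws + the leaves ON THE LAYERS -/

section Adapter

variable {M : ℕ} [NeZero M]

/-- **THE (D4) WALL AT NODE 00's [B13] OBJECTS OF RECORD.**  GIVEN a (1.21) sequence of residual layers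
`lam : ℕ → ResidB13 θ` with `(lam m).n ↗`, the p. 15 restriction law and the (2.13) law on every layer, Lemma 3
(2.38)_ℓ on every step of record, and EXACTLY the remaining leaves STATED ON THE LAYERS' OWN OBJECTS — the (4.4) seam
`emb m X : Wn m → (lam m).Φ` into `(lam m).sp2 X` with `v ↦ (lam m).Ek1 X (emb m X v)` complex-differentiable on the
α₂-ball ([I] §4), the (190)-side data on the tori `(lam m).n + 1` ([15] (190) ∕ [3] (2.61) ⟹ [I] p. 282), the
(1.7)-factorization ∕ test-vector-limit data with the read-out `a` ([I] (1.7), (1.21), (4.35)) — the holomorphic-currency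
wall `PolLeavesTFac190H 4 M a c ℓ α₂ q` is inhabited WITH `W m := (WtOfRecord θ (lam m)).toTorusStep`; `EXn`, `hcomp`,
`E2n`, `hrepr` by construction.  Nothing of Bałaban's is asserted: every binder is displayed.
[cite: Balaban1987RG1, (1.7) p.261, (1.21) p.264, (4.4) p.281, (4.35) p.290; Balaban1988RG2Cluster, p.15, (2.13) p.14, (2.38) p.20; Balaban1985Variational, (190) p.308] -/
def polLeavesTFac190H_ofLayers (lam : ℕ → ResidB13 θ) (hn : Tendsto (fun m => (lam m).n) atTop atTop)
    (c : B13.Consts) (ℓ α₂ : ℝ) (q : Consts190)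
    (hsp : ∀ m, SpLaw (lam m)) (h213 : ∀ m, Law213 (lam m))
    (h238 : ∀ m, B13.Bound238With (WtOfRecord θ (lam m)).toStepData c ℓ)
    (Wn : ℕ → Type) [instW : ∀ m, NormedAddCommGroup (Wn m)] [instWs : ∀ m, NormedSpace ℂ (Wn m)]
    (emb : (m : ℕ) → TDom 4 ((lam m).n + 1) → Wn m → (lam m).Φ)
    (hemb : ∀ m X, ∀ v ∈ ball (0 : Wn m) α₂, emb m X v ∈ (lam m).sp2 X)
    (hdiff : ∀ m X, DifferentiableOn ℂ (fun v => (lam m).Ek1 X (emb m X v)) (ball 0 α₂))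
    (D : Data190 4 M (NOfLayers lam) Wn q)
    (V : LDom 4 → Type) [instV : ∀ Y, NormedAddCommGroup (V Y)] [instVs : ∀ Y, NormedSpace ℂ (V Y)]
    (F : (Y : LDom 4) → V Y → ℂ) (hFd : ∀ Y, ∃ ρ > 0, DifferentiableOn ℂ (F Y) (ball 0 ρ))
    (r : (m : ℕ) → (Y : LDom 4) → Wn m →L[ℂ] V Y)
    (hfac : ∀ Y : LDom 4, ∀ᶠ m in atTop, ∀ v ∈ ball (0 : Wn m) α₂,
      (lam m).Ek1 (tproj ((lam m).n + 1) Y) (emb m (tproj ((lam m).n + 1) Y) v) = F Y (r m Y v))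
    (t : (Y : LDom 4) → Pt 4 → V Y)
    (hconv : ∀ (Y : LDom 4) (x : Pt 4),
      Tendsto (fun m => r m Y (D.hn m (tproj ((lam m).n + 1) Y) (proj (((lam m).n + 1) * M) x))) atTop
        (𝓝 (t Y x)))
    (a : LDom 4 → Pt 4 → ℝ) (ha : ∀ (Y : LDom 4) (z : Pt 4), a Y z = (mixedDeriv (F Y) (t Y 0) (t Y z)).re) :
    PolLeavesTFac190H 4 M a c ℓ α₂ q where
  N := NOfLayers lam
  hN := fun _ => inferInstance
  hNlim := tendsto_NOfLayers hn
  W := fun m => (WtOfRecord θ (lam m)).toTorusStep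
  hsp := fun m => spRestr_of_spLaw (hsp m)
  hrep := fun m => repr213_of_law213 (h213 m)
  h238 := h238
  Wn := Wn
  instW := instW
  instWs := instWs
  EXn := fun m X v => (lam m).Ek1 X (emb m X v)
  emb := emb
  hemb := hemb
  hcomp := fun _ _ _ => rfl
  D := D
  E2n := fun m X x y => (mixedDeriv (fun v => (lam m).Ek1 X (emb m X v)) (D.hn m X x) (D.hn m X y)).re
  hdiff := hdiff
  hrepr := fun _ _ _ _ => rfl
  V := V
  instV := instV
  instVs := instVs
  F := F
  hFd := hFd
  r := r
  hfac := hfac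
  t := t
  hconv := hconv
  ha := ha

/-- **WATCH-D4-TORUS-SEQUENCE handle, `W`**: the adapter's one-step data ARE the steps of record along the layer
sequence — `W m = (WtOfRecord θ (lam m)).toTorusStep` (`rfl`). [cite: Balaban1987RG1, (1.21) p.264] -/
theorem polLeavesTFac190H_ofLayers_W (lam : ℕ → ResidB13 θ) (hn : Tendsto (fun m => (lam m).n) atTop atTop)
    (c : B13.Consts) (ℓ α₂ : ℝ) (q : Consts190) (hsp : ∀ m, SpLaw (lam m)) (h213 : ∀ m, Law213 (lam m))
    (h238 : ∀ m, B13.Bound238With (WtOfRecord θ (lam m)).toStepData c ℓ)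
    (Wn : ℕ → Type) [instW : ∀ m, NormedAddCommGroup (Wn m)] [instWs : ∀ m, NormedSpace ℂ (Wn m)]
    (emb : (m : ℕ) → TDom 4 ((lam m).n + 1) → Wn m → (lam m).Φ)
    (hemb : ∀ m X, ∀ v ∈ ball (0 : Wn m) α₂, emb m X v ∈ (lam m).sp2 X)
    (hdiff : ∀ m X, DifferentiableOn ℂ (fun v => (lam m).Ek1 X (emb m X v)) (ball 0 α₂))
    (D : Data190 4 M (NOfLayers lam) Wn q)
    (V : LDom 4 → Type) [instV : ∀ Y, NormedAddCommGroup (V Y)] [instVs : ∀ Y, NormedSpace ℂ (V Y)]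
    (F : (Y : LDom 4) → V Y → ℂ) (hFd : ∀ Y, ∃ ρ > 0, DifferentiableOn ℂ (F Y) (ball 0 ρ))
    (r : (m : ℕ) → (Y : LDom 4) → Wn m →L[ℂ] V Y)
    (hfac : ∀ Y : LDom 4, ∀ᶠ m in atTop, ∀ v ∈ ball (0 : Wn m) α₂,
      (lam m).Ek1 (tproj ((lam m).n + 1) Y) (emb m (tproj ((lam m).n + 1) Y) v) = F Y (r m Y v))
    (t : (Y : LDom 4) → Pt 4 → V Y)
    (hconv : ∀ (Y : LDom 4) (x : Pt 4),
      Tendsto (fun m => r m Y (D.hn m (tproj ((lam m).n + 1) Y) (proj (((lam m).n + 1) * M) x))) atTop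
        (𝓝 (t Y x)))
    (a : LDom 4 → Pt 4 → ℝ) (ha : ∀ (Y : LDom 4) (z : Pt 4), a Y z = (mixedDeriv (F Y) (t Y 0) (t Y z)).re) :
    (polLeavesTFac190H_ofLayers lam hn c ℓ α₂ q hsp h213 h238 Wn emb hemb hdiff D V F hFd r hfac t hconv a ha).W =
      fun m => (WtOfRecord θ (lam m)).toTorusStep :=
  rfl

/-- **WATCH-D4-TORUS-SEQUENCE handle, `N`**: the adapter's tori ARE the layers' coarse tori — `N m = (lam m).n + 1`
(`rfl`), growing without bound by `hn`. [cite: Balaban1987RG1, (1.21) p.264] -/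
theorem polLeavesTFac190H_ofLayers_N (lam : ℕ → ResidB13 θ) (hn : Tendsto (fun m => (lam m).n) atTop atTop)
    (c : B13.Consts) (ℓ α₂ : ℝ) (q : Consts190) (hsp : ∀ m, SpLaw (lam m)) (h213 : ∀ m, Law213 (lam m))
    (h238 : ∀ m, B13.Bound238With (WtOfRecord θ (lam m)).toStepData c ℓ)
    (Wn : ℕ → Type) [instW : ∀ m, NormedAddCommGroup (Wn m)] [instWs : ∀ m, NormedSpace ℂ (Wn m)]
    (emb : (m : ℕ) → TDom 4 ((lam m).n + 1) → Wn m → (lam m).Φ)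
    (hemb : ∀ m X, ∀ v ∈ ball (0 : Wn m) α₂, emb m X v ∈ (lam m).sp2 X)
    (hdiff : ∀ m X, DifferentiableOn ℂ (fun v => (lam m).Ek1 X (emb m X v)) (ball 0 α₂))
    (D : Data190 4 M (NOfLayers lam) Wn q)
    (V : LDom 4 → Type) [instV : ∀ Y, NormedAddCommGroup (V Y)] [instVs : ∀ Y, NormedSpace ℂ (V Y)]
    (F : (Y : LDom 4) → V Y → ℂ) (hFd : ∀ Y, ∃ ρ > 0, DifferentiableOn ℂ (F Y) (ball 0 ρ))
    (r : (m : ℕ) → (Y : LDom 4) → Wn m →L[ℂ] V Y)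
    (hfac : ∀ Y : LDom 4, ∀ᶠ m in atTop, ∀ v ∈ ball (0 : Wn m) α₂,
      (lam m).Ek1 (tproj ((lam m).n + 1) Y) (emb m (tproj ((lam m).n + 1) Y) v) = F Y (r m Y v))
    (t : (Y : LDom 4) → Pt 4 → V Y)
    (hconv : ∀ (Y : LDom 4) (x : Pt 4),
      Tendsto (fun m => r m Y (D.hn m (tproj ((lam m).n + 1) Y) (proj (((lam m).n + 1) * M) x))) atTop
        (𝓝 (t Y x)))
    (a : LDom 4 → Pt 4 → ℝ) (ha : ∀ (Y : LDom 4) (z : Pt 4), a Y z = (mixedDeriv (F Y) (t Y 0) (t Y z)).re) :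
    (polLeavesTFac190H_ofLayers lam hn c ℓ α₂ q hsp h213 h238 Wn emb hemb hdiff D V F hFd r hfac t hconv a ha).N =
      fun m => (lam m).n + 1 :=
  rfl

/-! ## §4′ The adapter with the E-layer leaf derived from the layers' ACTIVITIES -/

/-- **The E-layer leaf `hdiff` of one layer FROM ITS ACTIVITIES** (road P3's seam lemma `hdiff_of_activities` at the
step of record): under the p. 15 and (2.13) laws, (2.38)_ℓ, `CondsL 4 c ℓ` and `0 ≤ C₃ε₁`, holomorphy of the layer's
activities `v ↦ H(Z, emb v)` for the polymers Z ⊆ X along a seam into Uᶜ_{k+1}(X, α₀, α₁) gives holomorphy of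
`v ↦ E^{(k+1)}(X, emb v)` on the α₂-ball ([II] p. 15 *"the activities in (2.13), and the whole sum E^{(k+1)}(X), are
analytic functions of (𝐔, 𝐉), on the space 𝐔ᶜ_{k+1}(X, α₀, α₁)"*). [cite: Balaban1988RG2Cluster, p.15 and p.20 (after (2.38)); Balaban1987RG1, (4.4) p.281] -/
theorem differentiableOn_Ek1_of_activities {lam : ResidB13 θ} (hsp : SpLaw lam) (h213 : Law213 lam)
    {c : B13.Consts} {ℓ : ℝ} (h238 : B13.Bound238With (WtOfRecord θ lam).toStepData c ℓ) (hC : CondsL 4 c ℓ)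
    (hA : 0 ≤ c.C3act * c.ε₁) {Wn : Type*} [NormedAddCommGroup Wn] [NormedSpace ℂ Wn] (X : TDom 4 (lam.n + 1))
    (emb : Wn → lam.Φ) {α₂ : ℝ} (hemb : ∀ v ∈ ball (0 : Wn) α₂, emb v ∈ lam.sp2 X)
    (hH : ∀ Z : TDom 4 (lam.n + 1), Z.1 ⊆ X.1 → DifferentiableOn ℂ (fun v => lam.H Z (emb v)) (ball 0 α₂)) :
    DifferentiableOn ℂ (fun v => lam.Ek1 X (emb v)) (ball 0 α₂) :=
  hdiff_of_activities (wallW lam) (spRestr_of_spLaw hsp) (repr213_of_law213 h213) h238 hC hA X emb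
    (fun v => lam.Ek1 X (emb v)) hemb (fun _ => rfl) hH

/-- **THE (D4) WALL AT THE RECORD's OBJECTS FROM THE H-LAYER**: `polLeavesTFac190H_ofLayers` with the E-layer leaf
`hdiff` REPLACED by holomorphy of the layers' ACTIVITIES along the seams (`hH`), at the price of `CondsL 4 c ℓ` and
`0 ≤ C₃ε₁` (both consumed by the (D4) END anyway). [cite: Balaban1987RG1, (1.7) p.261, (1.21) p.264, (4.4) p.281, (4.35) p.290; Balaban1988RG2Cluster, p.15 and (2.38) p.20; Balaban1985Variational, (190) p.308] -/
def polLeavesTFac190H_ofLayersOfActivities (lam : ℕ → ResidB13 θ)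
    (hn : Tendsto (fun m => (lam m).n) atTop atTop) (c : B13.Consts) (ℓ α₂ : ℝ) (q : Consts190)
    (hsp : ∀ m, SpLaw (lam m)) (h213 : ∀ m, Law213 (lam m))
    (h238 : ∀ m, B13.Bound238With (WtOfRecord θ (lam m)).toStepData c ℓ) (hC : CondsL 4 c ℓ)
    (hA : 0 ≤ c.C3act * c.ε₁)
    (Wn : ℕ → Type) [instW : ∀ m, NormedAddCommGroup (Wn m)] [instWs : ∀ m, NormedSpace ℂ (Wn m)]
    (emb : (m : ℕ) → TDom 4 ((lam m).n + 1) → Wn m → (lam m).Φ)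
    (hemb : ∀ m X, ∀ v ∈ ball (0 : Wn m) α₂, emb m X v ∈ (lam m).sp2 X)
    (hH : ∀ m (X Z : TDom 4 ((lam m).n + 1)), Z.1 ⊆ X.1 →
      DifferentiableOn ℂ (fun v => (lam m).H Z (emb m X v)) (ball 0 α₂))
    (D : Data190 4 M (NOfLayers lam) Wn q)
    (V : LDom 4 → Type) [instV : ∀ Y, NormedAddCommGroup (V Y)] [instVs : ∀ Y, NormedSpace ℂ (V Y)]
    (F : (Y : LDom 4) → V Y → ℂ) (hFd : ∀ Y, ∃ ρ > 0, DifferentiableOn ℂ (F Y) (ball 0 ρ))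
    (r : (m : ℕ) → (Y : LDom 4) → Wn m →L[ℂ] V Y)
    (hfac : ∀ Y : LDom 4, ∀ᶠ m in atTop, ∀ v ∈ ball (0 : Wn m) α₂,
      (lam m).Ek1 (tproj ((lam m).n + 1) Y) (emb m (tproj ((lam m).n + 1) Y) v) = F Y (r m Y v))
    (t : (Y : LDom 4) → Pt 4 → V Y)
    (hconv : ∀ (Y : LDom 4) (x : Pt 4),
      Tendsto (fun m => r m Y (D.hn m (tproj ((lam m).n + 1) Y) (proj (((lam m).n + 1) * M) x))) atTop
        (𝓝 (t Y x)))
    (a : LDom 4 → Pt 4 → ℝ) (ha : ∀ (Y : LDom 4) (z : Pt 4), a Y z = (mixedDeriv (F Y) (t Y 0) (t Y z)).re) :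
    PolLeavesTFac190H 4 M a c ℓ α₂ q :=
  polLeavesTFac190H_ofLayers lam hn c ℓ α₂ q hsp h213 h238 Wn emb hemb
    (fun m X => differentiableOn_Ek1_of_activities (hsp m) (h213 m) (h238 m) hC hA X (emb m X) (hemb m X)
      (hH m X))
    D V F hFd r hfac t hconv a ha

/-! ## §4″ The adapter with `h238` supplied by N10's [B13] leaves at the constants of record -/

/-- **THE (D4) WALL AT THE RECORD's OBJECTS FROM THE DAG's CURRENCIES**: as `polLeavesTFac190H_ofLayersOfActivities`,
the Lemma-3 leaf being N10's [B13] leaf `Node00.B13LeafOfRecord θ (lam m)` at every layer + the layers' restriction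
sentences, at COMMON constants of record `c` (`hc`) and the printed transfer factor ℓ = ½L.
[cite: Balaban1987RG1, (1.7) p.261, (1.21) p.264, (4.4) p.281, (4.35) p.290; Balaban1988RG2Cluster, p.15, Lemma 3 (2.38) p.20; Balaban1985Variational, (190) p.308] -/
def polLeavesTFac190H_ofRecordB13 (lam : ℕ → ResidB13 θ) (hn : Tendsto (fun m => (lam m).n) atTop atTop)
    (c : B13.Consts) (α₂ : ℝ) (q : Consts190) (hc : ∀ m, c13OfRecord θ (lam m) = c)
    (hsp : ∀ m, SpLaw (lam m)) (h213 : ∀ m, Law213 (lam m))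
    (hleaf : ∀ m, B13LeafOfRecord θ (lam m)) (hR : ∀ m, (lam m).Restr) (hC : CondsL 4 c ((c.L : ℝ) / 2))
    (hA : 0 ≤ c.C3act * c.ε₁)
    (Wn : ℕ → Type) [instW : ∀ m, NormedAddCommGroup (Wn m)] [instWs : ∀ m, NormedSpace ℂ (Wn m)]
    (emb : (m : ℕ) → TDom 4 ((lam m).n + 1) → Wn m → (lam m).Φ)
    (hemb : ∀ m X, ∀ v ∈ ball (0 : Wn m) α₂, emb m X v ∈ (lam m).sp2 X)
    (hH : ∀ m (X Z : TDom 4 ((lam m).n + 1)), Z.1 ⊆ X.1 →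
      DifferentiableOn ℂ (fun v => (lam m).H Z (emb m X v)) (ball 0 α₂))
    (D : Data190 4 M (NOfLayers lam) Wn q)
    (V : LDom 4 → Type) [instV : ∀ Y, NormedAddCommGroup (V Y)] [instVs : ∀ Y, NormedSpace ℂ (V Y)]
    (F : (Y : LDom 4) → V Y → ℂ) (hFd : ∀ Y, ∃ ρ > 0, DifferentiableOn ℂ (F Y) (ball 0 ρ))
    (r : (m : ℕ) → (Y : LDom 4) → Wn m →L[ℂ] V Y)
    (hfac : ∀ Y : LDom 4, ∀ᶠ m in atTop, ∀ v ∈ ball (0 : Wn m) α₂,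
      (lam m).Ek1 (tproj ((lam m).n + 1) Y) (emb m (tproj ((lam m).n + 1) Y) v) = F Y (r m Y v))
    (t : (Y : LDom 4) → Pt 4 → V Y)
    (hconv : ∀ (Y : LDom 4) (x : Pt 4),
      Tendsto (fun m => r m Y (D.hn m (tproj ((lam m).n + 1) Y) (proj (((lam m).n + 1) * M) x))) atTop
        (𝓝 (t Y x)))
    (a : LDom 4 → Pt 4 → ℝ) (ha : ∀ (Y : LDom 4) (z : Pt 4), a Y z = (mixedDeriv (F Y) (t Y 0) (t Y z)).re) :
    PolLeavesTFac190H 4 M a c ((c.L : ℝ) / 2) α₂ q :=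
  polLeavesTFac190H_ofLayersOfActivities lam hn c ((c.L : ℝ) / 2) α₂ q hsp h213 (h238_of_b13Leaves hc hleaf hR)
    hC hA Wn emb hemb hH D V F hFd r hfac t hconv a ha

end Adapter

end Literature.MathematicalPhysics.QuantumFieldTheory.Balaban1983to89.Beta.RemainderWOfRecordB13

end
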